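import Literature.Analysis.FluidPDE.HeatDivFormGradientL2
import HarnessLib

/-!
# The `L^m → L^r` improvement for `∂ₜw - Δw = div g` up to the top, with the bound on the norms

Analysis/FluidPDE proofs file (theorems only; no definitions, no named facts). The accepted
`HeatDivForm.heatDivForm_improvement_top` (`HeatDivFormTopImprovement.lean`; Robinson–Rodrigo–
Sadowski 2016, proof of Thm. 13.7, §13.3.2 Step 2 with Thms. D.6–D.7 and the Duhamel formula
(D.2), isotropic exponents) concludes `w ∈ L^r` on the inner cylinder qualitatively. Its proof is
quantitative: the localised solution is a sum of forward heat potentials of the data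
`H = w(∂ₜφ + Δφ) - ⟪g, ∇φ⟫`, `Fᵢ = φgᵢ - 2w∂ᵢφ`, and Young's inequality bounds their `L^r` norms by
`‖kernel‖_{L^p} ‖data‖_{L^m}`. This file records the resulting estimate, **with the constant fixed
before the solution** (it depends on the exponents and the geometry only):

* `HeatDivForm.heatDivForm_improvement_top_quant` — for `1 < m ≤ r ≤ ∞`, `1/m < 1/r + 1/5`,
  `0 < L' < L`, `0 < ρ' < ρ` there is `C` such that every distributional solution
  `w ∈ L^m(Q)`, `Q = ]-L, 0[ × B(0, ρ) ⊆ ℝ × ℝ³`, of `∂ₜw - Δw = div g`, `g ∈ L^m(Q)`, satisfies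
  `‖w‖_{L^r(Q')} ≤ C (‖w‖_{L^m(Q)} + ‖g‖_{L^m(Q)})` on `Q' = ]-L', 0[ × B(0, ρ')` (no layer lost at
  the top time).

This is the form consumed by regularity statements which track the dependence of the norms on the
data (e.g. Seregin–Šverák 2009, §2 p. 8, `NSBoundedHigherRegularityBounds`): three rounds
`L² → L³ → L⁶ → L^∞` with such constants bound the vorticity of a bounded Navier–Stokes solution,
and then its derivatives, by the data. Cylinders are normalised to top time `0` and centre `0`
(translate the data).

## Proof

Verbatim the accepted proof (cut-off `φ` reaching over the top, duality with the backward
Duhamel integral of test functions supported in `{t < 0}`, representation by truncated forward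
kernels, du Bois-Reymond on `{t < 0}`), with the cut-off, the truncation time and the Young
exponent chosen before `w, g`, followed by Minkowski's and Young's inequalities with the norms
kept (`Convolution.eLpNorm_convolution_le_young`) and the pointwise bounds
`|H| ≤ (sup|∂ₜφ| + sup|Δφ|)|w| + 3 sup‖Dφ‖ ‖g‖`, `|Fᵢ| ≤ sup|φ| ‖g‖ + 2 sup‖Dφ‖ |w|`.

## References

* J. C. Robinson, J. L. Rodrigo, W. Sadowski, *The Three-Dimensional Navier–Stokes Equations.
  Classical theory*, CUP 2016: §13.3.2 Steps 1–2, (13.11)–(13.17); App. D, (D.2), Thms. D.6–D.7;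
  App. A, Thm. A.10 (Young). [`RobinsonRodrigoSadowskiCUP2016`]
* G. Seregin, V. Šverák, Comm. PDE 34 (2009) = arXiv:0804.1803, §2 p. 8 (norms estimated by the
  data). [`SereginSverak2009`]
-/

noncomputable section

open MeasureTheory Set Function Filter Topology TopologicalSpace Metric
open scoped NNReal ENNReal RealInnerProductSpace Laplacian Convolution

namespace Literature.Analysis.FluidPDE

namespace HeatDivForm

section General

variable {E : Type*} [NormedAddCommGroup E] [InnerProductSpace ℝ E] [FiniteDimensional ℝ E]
  [MeasurableSpace E] [BorelSpace E]
variable {ι : Type*} [Fintype ι]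

/-- **`L^p` bound for the scalar localised datum**:
`‖locH‖_p ≤ (Kₜ + K_Δ) ‖w‖_p + (card ι) K_D ‖g‖_p` (`1 ≤ p`). [folklore] -/
theorem eLpNorm_locH_le_of_bounds (b : OrthonormalBasis ι ℝ E) {φ : ℝ → E → ℝ}
    (hφ : IsSpaceTimeTestOn (⊤ : Opens (ℝ × E)) φ) {w : ℝ × E → ℝ} {g : ℝ × E → E} {p : ℝ≥0∞}
    (hp : 1 ≤ p) (hw : MemLp w p (volume : Measure (ℝ × E))) (hg : MemLp g p (volume : Measure (ℝ × E)))
    {Kt Kl Kg : ℝ} (hKt0 : 0 ≤ Kt) (hKl0 : 0 ≤ Kl) (hKg0 : 0 ≤ Kg)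
    (hKt : ∀ t x, ‖timeDeriv φ t x‖ ≤ Kt) (hKl : ∀ t x, ‖(Δ (φ t)) x‖ ≤ Kl)
    (hKg : ∀ t x i, ‖fderiv ℝ (φ t) x (b i)‖ ≤ Kg) :
    eLpNorm (locH b φ w g) p (volume : Measure (ℝ × E)) ≤
      ENNReal.ofReal (Kt + Kl) * eLpNorm w p (volume : Measure (ℝ × E)) +
        ENNReal.ofReal ((Fintype.card ι : ℝ) * Kg) * eLpNorm g p (volume : Measure (ℝ × E)) := by
  set A : ℝ × E → ℝ := fun q => w q * (timeDeriv φ q.1 q.2 + (Δ (φ q.1)) q.2) with hA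
  set B : ℝ × E → ℝ := fun q => ∑ i, ⟪g q, b i⟫ * fderiv ℝ (φ q.1) q.2 (b i) with hB
  have hHeq : locH b φ w g = A - B := by funext q; simp [locH, hA, hB]
  have hφs : ContDiff ℝ ((⊤ : ℕ∞) : WithTop ℕ∞) (uncurry φ) := hφ.contDiff
  have cχ : Continuous fun q : ℝ × E => timeDeriv φ q.1 q.2 + (Δ (φ q.1)) q.2 :=
    (continuous_timeDeriv_of_contDiff hφs).add (continuous_laplacian_slice_of_contDiff hφs)
  have cdφ : ∀ i, Continuous fun q : ℝ × E => fderiv ℝ (φ q.1) q.2 (b i) := fun i =>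
    continuous_fderiv_slice_apply_of_contDiff hφs (b i)
  have hAm : AEStronglyMeasurable A volume := hw.1.mul cχ.aestronglyMeasurable
  have hBm : AEStronglyMeasurable B volume :=
    Finset.aestronglyMeasurable_fun_sum _ fun i _ => (hg.1.inner aestronglyMeasurable_const).mul
      (cdφ i).aestronglyMeasurable
  have hA2 : eLpNorm A p volume ≤ ENNReal.ofReal (Kt + Kl) * eLpNorm w p volume := by
    refine eLpNorm_le_ofReal_mul_of_le (by positivity) (fun q => ?_) p
    rw [hA, norm_mul, mul_comm]
    refine mul_le_mul_of_nonneg_right ?_ (norm_nonneg _)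
    exact (norm_add_le _ _).trans (add_le_add (hKt q.1 q.2) (hKl q.1 q.2))
  have hB2 : eLpNorm B p volume ≤ ENNReal.ofReal ((Fintype.card ι : ℝ) * Kg) * eLpNorm g p volume := by
    refine eLpNorm_le_ofReal_mul_of_le (by positivity) (fun q => ?_) p
    rw [hB, Real.norm_eq_abs]
    refine (Finset.abs_sum_le_sum_abs _ _).trans ?_
    exact sum_abs_inner_mul_le b (g q) (c := fun i => fderiv ℝ (φ q.1) q.2 (b i)) (K := Kg)
      fun i => by simpa [Real.norm_eq_abs] using hKg q.1 q.2 i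
  rw [hHeq]
  exact (eLpNorm_sub_le hAm hBm hp).trans (add_le_add hA2 hB2)

/-- **`L^p` bound for the vector localised data**: `‖locFᵢ‖_p ≤ K₀ ‖g‖_p + 2 K_D ‖w‖_p` when
`|φ| ≤ K₀`, `|∂ᵢφ| ≤ K_D` (`1 ≤ p`). [folklore] -/
theorem eLpNorm_locF_le_of_bounds (b : OrthonormalBasis ι ℝ E) {φ : ℝ → E → ℝ}
    (hφ : IsSpaceTimeTestOn (⊤ : Opens (ℝ × E)) φ) {w : ℝ × E → ℝ} {g : ℝ × E → E} {p : ℝ≥0∞}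
    (hp : 1 ≤ p) (hw : MemLp w p (volume : Measure (ℝ × E))) (hg : MemLp g p (volume : Measure (ℝ × E)))
    {K₀ Kg : ℝ} (hK₀0 : 0 ≤ K₀) (hKg0 : 0 ≤ Kg) (hK₀ : ∀ t x, ‖φ t x‖ ≤ K₀)
    (hKg : ∀ t x i, ‖fderiv ℝ (φ t) x (b i)‖ ≤ Kg) (i : ι) :
    eLpNorm (locF b φ w g i) p (volume : Measure (ℝ × E)) ≤
      ENNReal.ofReal K₀ * eLpNorm g p (volume : Measure (ℝ × E)) +
        ENNReal.ofReal (2 * Kg) * eLpNorm w p (volume : Measure (ℝ × E)) := by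
  set A : ℝ × E → ℝ := fun q => φ q.1 q.2 * ⟪g q, b i⟫ with hA
  set B : ℝ × E → ℝ := fun q => 2 * w q * fderiv ℝ (φ q.1) q.2 (b i) with hB
  have hFeq : locF b φ w g i = A - B := by funext q; simp [locF, hA, hB]
  have hφs : ContDiff ℝ ((⊤ : ℕ∞) : WithTop ℕ∞) (uncurry φ) := hφ.contDiff
  have cφ : Continuous fun q : ℝ × E => φ q.1 q.2 := hφs.continuous
  have cdφ : Continuous fun q : ℝ × E => fderiv ℝ (φ q.1) q.2 (b i) :=
    continuous_fderiv_slice_apply_of_contDiff hφs (b i)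
  have hAm : AEStronglyMeasurable A volume :=
    cφ.aestronglyMeasurable.mul (hg.1.inner aestronglyMeasurable_const)
  have hBm : AEStronglyMeasurable B volume :=
    ((hw.1.const_mul 2).mul cdφ.aestronglyMeasurable)
  have hA2 : eLpNorm A p volume ≤ ENNReal.ofReal K₀ * eLpNorm g p volume := by
    refine eLpNorm_le_ofReal_mul_of_le hK₀0 (fun q => ?_) p
    rw [hA, norm_mul]
    refine mul_le_mul (hK₀ q.1 q.2) ?_ (norm_nonneg _) hK₀0
    calc ‖⟪g q, b i⟫‖ ≤ ‖g q‖ * ‖b i‖ := norm_inner_le_norm _ _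
      _ = ‖g q‖ := by rw [b.orthonormal.1 i, mul_one]
  have hB2 : eLpNorm B p volume ≤ ENNReal.ofReal (2 * Kg) * eLpNorm w p volume := by
    refine eLpNorm_le_ofReal_mul_of_le (by positivity) (fun q => ?_) p
    rw [hB, norm_mul, norm_mul, Real.norm_two]
    calc 2 * ‖w q‖ * ‖fderiv ℝ (φ q.1) q.2 (b i)‖ ≤ 2 * ‖w q‖ * Kg := by
          gcongr; exact hKg q.1 q.2 i
      _ = 2 * Kg * ‖w q‖ := by ring
  rw [hFeq]
  exact (eLpNorm_sub_le hAm hBm hp).trans (add_le_add hA2 hB2)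

end General

/-! ## The quantitative improvement up to the top in `ℝ³` -/

section R3

set_option maxHeartbeats 1600000 in
/-- **The `L^m → L^r` improvement for `∂ₜw - Δw = div g`, up to the top, with the bound on the
norms** (Robinson–Rodrigo–Sadowski 2016, proof of Thm. 13.7, §13.3.2 Step 2 with Thms. D.6–D.7 and
(D.2), isotropic exponents; the constant tracked). Let `1 < m ≤ r ≤ ∞` with `1/m < 1/r + 1/5`,
`0 < L' < L`, `0 < ρ' < ρ`. There is `C` (depending on these numbers only) such that: if
`w, g ∈ L^m(Q)`, `Q = ]-L, 0[ × B(0, ρ) ⊆ ℝ × ℝ³`, satisfy `∫ w (∂ₜψ + Δψ) = ∫ ⟪g, ∇ψ⟫` for all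
`ψ ∈ C_c^∞(Q)`, then `w ∈ L^r(Q')`, `Q' = ]-L', 0[ × B(0, ρ')`, and
`‖w‖_{L^r(Q')} ≤ C (‖w‖_{L^m(Q)} + ‖g‖_{L^m(Q)})`. Proof: module docstring.
[cite: RobinsonRodrigoSadowskiCUP2016, §13.3.2 Step 2 ((13.11)–(13.16)) with Thms. D.6–D.7 (isotropic case), (D.2) and Thm. A.10] -/
theorem heatDivForm_improvement_top_quant {m r : ℝ≥0∞} (h1m : 1 < m) (hmr : m ≤ r)
    (hexp : m⁻¹ < r⁻¹ + 5⁻¹) {L L' ρ ρ' : ℝ} (hL' : 0 < L') (hL : L' < L) (hρ'0 : 0 < ρ')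
    (hρ'ρ : ρ' < ρ) :
    ∃ C : ℝ≥0, ∀ (w : ℝ × (EuclideanSpace ℝ (Fin 3)) → ℝ)
      (g : ℝ × (EuclideanSpace ℝ (Fin 3)) → (EuclideanSpace ℝ (Fin 3))),
      MemLp w m (volume.restrict (Ioo (-L) 0 ×ˢ ball (0 : EuclideanSpace ℝ (Fin 3)) ρ)) →
      MemLp g m (volume.restrict (Ioo (-L) 0 ×ˢ ball (0 : EuclideanSpace ℝ (Fin 3)) ρ)) →
      (∀ ψ : ℝ → (EuclideanSpace ℝ (Fin 3)) → ℝ,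
        IsSpaceTimeTestOn (⟨Ioo (-L) 0 ×ˢ ball (0 : EuclideanSpace ℝ (Fin 3)) ρ,
          isOpen_Ioo.prod isOpen_ball⟩ : Opens (ℝ × (EuclideanSpace ℝ (Fin 3)))) ψ →
        ∫ q : ℝ × (EuclideanSpace ℝ (Fin 3)), w q * (timeDeriv ψ q.1 q.2 + (Δ (ψ q.1)) q.2) =
          ∫ q : ℝ × (EuclideanSpace ℝ (Fin 3)), ⟪g q, gradient (ψ q.1) q.2⟫) →
      MemLp w r (volume.restrict (Ioo (-L') 0 ×ˢ ball (0 : EuclideanSpace ℝ (Fin 3)) ρ')) ∧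
      eLpNorm w r (volume.restrict (Ioo (-L') 0 ×ˢ ball (0 : EuclideanSpace ℝ (Fin 3)) ρ')) ≤
        C * (eLpNorm w m (volume.restrict (Ioo (-L) 0 ×ˢ ball (0 : EuclideanSpace ℝ (Fin 3)) ρ)) +
          eLpNorm g m (volume.restrict (Ioo (-L) 0 ×ˢ ball (0 : EuclideanSpace ℝ (Fin 3)) ρ))) := by
  haveI := isAddLeftInvariant_volume_real_prod (E := (EuclideanSpace ℝ (Fin 3)))
  haveI := isAddRightInvariant_volume_real_prod (E := (EuclideanSpace ℝ (Fin 3)))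
  haveI := isNegInvariant_volume_real_prod (E := (EuclideanSpace ℝ (Fin 3)))
  have hm1 : 1 ≤ m := h1m.le
  have hr1 : 1 ≤ r := hm1.trans hmr
  -- the data fixed before the solution: cut-off, its bounds, truncation time, Young exponent
  obtain ⟨φ, hφ, hφsupp, hφ1⟩ := exists_top_cutoff (a := -L) (a' := -L') (T := 0)
    (by linarith) (by linarith) hρ'0 hρ'ρ (0 : EuclideanSpace ℝ (Fin 3))
  obtain ⟨a₁, b₁, hab₁⟩ := exists_time_bounds_of_isSpaceTimeTestOn hφ
  set bs := stdOrthonormalBasis ℝ (EuclideanSpace ℝ (Fin 3)) with hbs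
  obtain ⟨K₀, hK₀0, hK₀⟩ := hφ.exists_norm_le
  obtain ⟨Kt, hKt0, hKt⟩ := hφ.timeDeriv_top.exists_norm_le
  obtain ⟨Kl, hKl0, hKl⟩ := hφ.laplacian_top.exists_norm_le
  obtain ⟨Kg, hKg0, hKg⟩ := hφ.fderiv_top.exists_norm_le
  have hKgi : ∀ t x i, ‖fderiv ℝ (φ t) x (bs i)‖ ≤ Kg := fun t x i =>
    (ContinuousLinearMap.le_opNorm _ _).trans (by rw [bs.orthonormal.1 i, mul_one]; exact hKg t x)
  obtain ⟨p, hp1, hptop, hp54, hpm⟩ := exists_kernel_exponent h1m hmr hexp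
  set Tc : ℝ := 0 - a₁ with hTc
  have hd3 : Module.finrank ℝ (EuclideanSpace ℝ (Fin 3)) = 3 := by simp
  have hK0 : MemLp (fwdKernelCut (UnboundedOperators.heatKernel (E := (EuclideanSpace ℝ (Fin 3)))) Tc) p
      (volume : Measure (ℝ × (EuclideanSpace ℝ (Fin 3)))) :=
    memLp_fwdKernelCut_heatKernel Tc hp1 hptop (by rw [hd3]; norm_num; linarith)
  have hKi : ∀ i, MemLp (fwdKernelCut (heatKernelGrad (bs i)) Tc) p
      (volume : Measure (ℝ × (EuclideanSpace ℝ (Fin 3)))) :=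
    fun i => memLp_fwdKernelCut_heatKernelGrad (bs i) Tc hp1 hptop (by rw [hd3]; norm_num; linarith)
  set NK0 : ℝ≥0∞ := eLpNorm (fwdKernelCut (UnboundedOperators.heatKernel
    (E := (EuclideanSpace ℝ (Fin 3)))) Tc) p (volume : Measure (ℝ × (EuclideanSpace ℝ (Fin 3)))) with hNK0
  set NK : Fin (Module.finrank ℝ (EuclideanSpace ℝ (Fin 3))) → ℝ≥0∞ := fun i =>
    eLpNorm (fwdKernelCut (heatKernelGrad (bs i)) Tc) p (volume : Measure (ℝ × (EuclideanSpace ℝ (Fin 3))))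
    with hNK
  have hNK0top : NK0 ≠ ⊤ := hK0.eLpNorm_ne_top
  have hNKtop : ∀ i, NK i ≠ ⊤ := fun i => (hKi i).eLpNorm_ne_top
  set n3 : ℝ := (Fintype.card (Fin (Module.finrank ℝ (EuclideanSpace ℝ (Fin 3)))) : ℝ) with hn3
  have hn30 : 0 ≤ n3 := Nat.cast_nonneg _
  set Cw : ℝ≥0∞ := NK0 * ENNReal.ofReal (Kt + Kl) + (∑ i, NK i) * ENNReal.ofReal (2 * Kg) with hCw
  set Cg : ℝ≥0∞ := NK0 * ENNReal.ofReal (n3 * Kg) + (∑ i, NK i) * ENNReal.ofReal K₀ with hCg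
  have hsumtop : (∑ i, NK i) ≠ ⊤ := ENNReal.sum_ne_top.2 fun i _ => hNKtop i
  have hCwtop : Cw ≠ ⊤ := ENNReal.add_ne_top.2
    ⟨ENNReal.mul_ne_top hNK0top ENNReal.ofReal_ne_top, ENNReal.mul_ne_top hsumtop ENNReal.ofReal_ne_top⟩
  have hCgtop : Cg ≠ ⊤ := ENNReal.add_ne_top.2
    ⟨ENNReal.mul_ne_top hNK0top ENNReal.ofReal_ne_top, ENNReal.mul_ne_top hsumtop ENNReal.ofReal_ne_top⟩
  refine ⟨(Cw + Cg).toNNReal, fun w g hw hg heq => ?_⟩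
  have hCeq : (((Cw + Cg).toNNReal : ℝ≥0) : ℝ≥0∞) = Cw + Cg :=
    ENNReal.coe_toNNReal (ENNReal.add_ne_top.2 ⟨hCwtop, hCgtop⟩)
  -- names
  set Qs : Set (ℝ × (EuclideanSpace ℝ (Fin 3))) := Ioo (-L) 0 ×ˢ ball (0 : EuclideanSpace ℝ (Fin 3)) ρ
    with hQs
  set Qo : Opens (ℝ × (EuclideanSpace ℝ (Fin 3))) := ⟨Qs, isOpen_Ioo.prod isOpen_ball⟩ with hQo
  have hQmeas : MeasurableSet Qs := (isOpen_Ioo.prod isOpen_ball).measurableSet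
  have hQfin : volume Qs < ⊤ := volume_Ioo_prod_ball_lt_top (-L) 0 0 ρ
  haveI : IsFiniteMeasure ((volume : Measure (ℝ × (EuclideanSpace ℝ (Fin 3)))).restrict Qs) :=
    isFiniteMeasure_restrict.2 hQfin.ne
  -- Step A: extension by zero
  set w' : ℝ × (EuclideanSpace ℝ (Fin 3)) → ℝ := Qs.indicator w with hw'
  set g' : ℝ × (EuclideanSpace ℝ (Fin 3)) → (EuclideanSpace ℝ (Fin 3)) := Qs.indicator g with hg'
  have hw'm : MemLp w' m (volume : Measure (ℝ × (EuclideanSpace ℝ (Fin 3)))) :=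
    (memLp_indicator_iff_restrict hQmeas).2 hw
  have hg'm : MemLp g' m (volume : Measure (ℝ × (EuclideanSpace ℝ (Fin 3)))) :=
    (memLp_indicator_iff_restrict hQmeas).2 hg
  have hw'i : Integrable w' (volume : Measure (ℝ × (EuclideanSpace ℝ (Fin 3)))) :=
    IntegrableOn.integrable_indicator (hw.integrable hm1) hQmeas
  have hg'i : Integrable g' (volume : Measure (ℝ × (EuclideanSpace ℝ (Fin 3)))) :=
    IntegrableOn.integrable_indicator (hg.integrable hm1) hQmeas
  have hNw : eLpNorm w' m (volume : Measure (ℝ × (EuclideanSpace ℝ (Fin 3)))) =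
      eLpNorm w m (volume.restrict Qs) := eLpNorm_indicator_eq_eLpNorm_restrict hQmeas
  have hNg : eLpNorm g' m (volume : Measure (ℝ × (EuclideanSpace ℝ (Fin 3)))) =
      eLpNorm g m (volume.restrict Qs) := eLpNorm_indicator_eq_eLpNorm_restrict hQmeas
  have heq' : ∀ ψ : ℝ → (EuclideanSpace ℝ (Fin 3)) → ℝ, IsSpaceTimeTestOn Qo ψ →
      ∫ q : ℝ × (EuclideanSpace ℝ (Fin 3)), w' q * (timeDeriv ψ q.1 q.2 + (Δ (ψ q.1)) q.2) =
        ∫ q : ℝ × (EuclideanSpace ℝ (Fin 3)), ⟪g' q, gradient (ψ q.1) q.2⟫ := by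
    intro ψ hψ
    have e1 : (fun q : ℝ × (EuclideanSpace ℝ (Fin 3)) => w' q * (timeDeriv ψ q.1 q.2 + (Δ (ψ q.1)) q.2)) =
        fun q => w q * (timeDeriv ψ q.1 q.2 + (Δ (ψ q.1)) q.2) := by
      funext q
      by_cases hq : q ∈ Qs
      · rw [hw', indicator_of_mem hq]
      · have hq' : q ∉ tsupport (uncurry ψ) := fun h => hq (hψ.tsupport_subset h)
        rw [IsSpaceTimeTestOn.timeDeriv_eq_zero_of_notMem (ψ := ψ) (t := q.1) (x := q.2) hq',
          laplacian_slice_eq_zero_of_notMem_tsupport (ψ := ψ) (t := q.1) (x := q.2) hq']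
        simp
    have e2 : (fun q : ℝ × (EuclideanSpace ℝ (Fin 3)) => ⟪g' q, gradient (ψ q.1) q.2⟫) =
        fun q => ⟪g q, gradient (ψ q.1) q.2⟫ := by
      funext q
      by_cases hq : q ∈ Qs
      · rw [hg', indicator_of_mem hq]
      · have hq' : q ∉ tsupport (uncurry ψ) := fun h => hq (hψ.tsupport_subset h)
        rw [hψ.continuous_gradient_field.2.2 q hq']
        simp
    rw [e1, e2]
    exact heq ψ hψ
  -- Step B: the localised data
  set H : ℝ × (EuclideanSpace ℝ (Fin 3)) → ℝ := locH bs φ w' g' with hH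
  set F : Fin (Module.finrank ℝ (EuclideanSpace ℝ (Fin 3))) → ℝ × (EuclideanSpace ℝ (Fin 3)) → ℝ :=
    fun i => locF bs φ w' g' i with hF
  have hHm : MemLp H m (volume : Measure (ℝ × (EuclideanSpace ℝ (Fin 3)))) := memLp_locH bs hφ hw'm hg'm
  have hFm : ∀ i, MemLp (F i) m (volume : Measure (ℝ × (EuclideanSpace ℝ (Fin 3)))) := fun i =>
    memLp_locF bs hφ hw'm hg'm i
  have hHsupp : ∀ q, H q ≠ 0 → q.1 ∈ Icc a₁ b₁ := fun q hq =>
    hab₁ q (by by_contra h'; exact hq (locH_eq_zero_of_notMem bs w' g' h'))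
  have hFsupp : ∀ i q, F i q ≠ 0 → q.1 ∈ Icc a₁ b₁ := fun i q hq =>
    hab₁ q (by by_contra h'; exact hq (locF_eq_zero_of_notMem bs w' g' i h'))
  -- Step C: the potentials
  set P0 : ℝ × (EuclideanSpace ℝ (Fin 3)) → ℝ := fwdKernelCut (UnboundedOperators.heatKernel
      (E := (EuclideanSpace ℝ (Fin 3)))) Tc
    ⋆[ContinuousLinearMap.lsmul ℝ ℝ, (volume : Measure (ℝ × (EuclideanSpace ℝ (Fin 3))))] H with hP0
  set Pi : Fin (Module.finrank ℝ (EuclideanSpace ℝ (Fin 3))) → ℝ × (EuclideanSpace ℝ (Fin 3)) → ℝ :=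
    fun i => fwdKernelCut (heatKernelGrad (bs i)) Tc
      ⋆[ContinuousLinearMap.lsmul ℝ ℝ, (volume : Measure (ℝ × (EuclideanSpace ℝ (Fin 3))))] F i
    with hPi
  have hP0m : MemLp P0 r (volume : Measure (ℝ × (EuclideanSpace ℝ (Fin 3)))) :=
    Convolution.memLp_convolution_of_memLp hp1 hm1 hpm hK0 hHm
  have hPim : ∀ i, MemLp (Pi i) r (volume : Measure (ℝ × (EuclideanSpace ℝ (Fin 3)))) := fun i =>
    Convolution.memLp_convolution_of_memLp hp1 hm1 hpm (hKi i) (hFm i)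
  have hP0n : eLpNorm P0 r (volume : Measure (ℝ × (EuclideanSpace ℝ (Fin 3)))) ≤ NK0 * eLpNorm H m volume :=
    Convolution.eLpNorm_convolution_le_young hK0.1 hHm.1 hp1 hm1 hpm
  have hPin : ∀ i, eLpNorm (Pi i) r (volume : Measure (ℝ × (EuclideanSpace ℝ (Fin 3)))) ≤
      NK i * eLpNorm (F i) m volume := fun i =>
    Convolution.eLpNorm_convolution_le_young (hKi i).1 (hFm i).1 hp1 hm1 hpm
  set V : ℝ × (EuclideanSpace ℝ (Fin 3)) → ℝ := fun q => P0 q - ∑ i, Pi i q with hV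
  have hVm : MemLp V r (volume : Measure (ℝ × (EuclideanSpace ℝ (Fin 3)))) :=
    hP0m.sub (memLp_finsetSum _ fun i _ => hPim i)
  have hVloc : LocallyIntegrable V (volume : Measure (ℝ × (EuclideanSpace ℝ (Fin 3)))) := hVm.locallyIntegrable hr1
  have hP0loc : LocallyIntegrable P0 (volume : Measure (ℝ × (EuclideanSpace ℝ (Fin 3)))) := hP0m.locallyIntegrable hr1
  have hPiloc : ∀ i, LocallyIntegrable (Pi i) (volume : Measure (ℝ × (EuclideanSpace ℝ (Fin 3)))) := fun i =>
    (hPim i).locallyIntegrable hr1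
  -- the localised solution
  set W : ℝ × (EuclideanSpace ℝ (Fin 3)) → ℝ := fun q => φ q.1 q.2 * w' q with hW
  have hWi : Integrable W (volume : Measure (ℝ × (EuclideanSpace ℝ (Fin 3)))) := by
    have h : Integrable (fun q : ℝ × (EuclideanSpace ℝ (Fin 3)) => w' q * φ q.1 q.2)
        (volume : Measure (ℝ × (EuclideanSpace ℝ (Fin 3)))) :=
      integrable_mul_of_continuous_hasCompactSupport hw'i hφ.contDiff.continuous hφ.hasCompactSupport
    refine h.congr (Eventually.of_forall fun q => ?_)
    simp only [hW]; ring
  -- Step D: the tested identity on the half-space `{t < 0}`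
  set O : Opens (ℝ × (EuclideanSpace ℝ (Fin 3))) := slab (EuclideanSpace ℝ (Fin 3)) (Iio 0) isOpen_Iio with hO
  have hmemO : ∀ q : ℝ × (EuclideanSpace ℝ (Fin 3)), q ∈ (O : Set (ℝ × (EuclideanSpace ℝ (Fin 3)))) ↔ q.1 < 0 :=
    fun q => by rw [hO, SetLike.mem_coe, mem_slab, mem_Iio]
  have hid : ∀ θ : ℝ × (EuclideanSpace ℝ (Fin 3)) → ℝ, ContDiff ℝ ((⊤ : ℕ∞) : WithTop ℕ∞) θ → HasCompactSupport θ →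
      tsupport θ ⊆ (O : Set (ℝ × (EuclideanSpace ℝ (Fin 3)))) →
      ∫ q, θ q • (W q - V q) = 0 := by
    intro θ hθs hθc hθO
    set Θ : ℝ → (EuclideanSpace ℝ (Fin 3)) → ℝ := fun t x => θ (t, x) with hΘ
    have hΘe : uncurry Θ = θ := rfl
    have hΘt : IsSpaceTimeTestOn (⊤ : Opens (ℝ × (EuclideanSpace ℝ (Fin 3)))) Θ := ⟨hθs, hθc, by simp⟩
    obtain ⟨a₀, b₀, -, hb₀T, hab₀⟩ :=
      exists_time_support_lt_top (E := (EuclideanSpace ℝ (Fin 3))) (ψ := Θ) hθc (fun q hq => (hmemO q).1 (hθO hq))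
    have hU0 : ∀ s, b₀ ≤ s → ∀ x, heatDuhamelBack 1 Θ s x = 0 := fun s hs x =>
      hΘt.heatDuhamelBack_eq_zero_of_le one_pos hab₀ hs x
    have hψ : IsSpaceTimeTestOn Qo (fun t x => φ t x * heatDuhamelBack 1 Θ t x) := by
      refine isSpaceTimeTestOn_mul_of_eq_zero_of_le hφ
        (hΘt.contDiff_uncurry_heatDuhamelBack_infty one_pos) hU0 fun q hq hqb => ?_
      obtain ⟨hq1, hq2⟩ := hφsupp q hq
      change q ∈ Ioo (-L) 0 ×ˢ ball (0 : EuclideanSpace ℝ (Fin 3)) ρ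
      refine ⟨⟨by linarith, by linarith⟩, ?_⟩
      rw [mem_ball]
      linarith
    have key := integral_cutoff_mul_mul_test_eq_potentials_of_test bs hw'i hg'i heq' hφ hΘt hψ
    rw [hΘe] at key
    have hθ0 : ∀ q, θ q ≠ 0 → q.1 < 0 := fun q hq =>
      (hmemO q).1 (hθO (subset_tsupport _ hq))
    have t0 := integral_test_mul_fwd_eq_fwdCut (κ := UnboundedOperators.heatKernel
      (E := (EuclideanSpace ℝ (Fin 3)))) hθ0 hHsupp (T := Tc) le_rfl
    have ti := fun i => integral_test_mul_fwd_eq_fwdCut (κ := heatKernelGrad (bs i)) hθ0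
      (hFsupp i) (T := Tc) le_rfl
    rw [t0, Finset.sum_congr rfl fun i _ => ti i] at key
    have I0 : Integrable (fun q => θ q * P0 q) (volume : Measure (ℝ × (EuclideanSpace ℝ (Fin 3)))) :=
      hP0loc.integrable_smul_left_of_hasCompactSupport hθs.continuous hθc
    have Ii : ∀ i, Integrable (fun q => θ q * Pi i q) (volume : Measure (ℝ × (EuclideanSpace ℝ (Fin 3)))) := fun i =>
      (hPiloc i).integrable_smul_left_of_hasCompactSupport hθs.continuous hθc
    have IW : Integrable (fun q => θ q * W q) (volume : Measure (ℝ × (EuclideanSpace ℝ (Fin 3)))) :=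
      hWi.locallyIntegrable.integrable_smul_left_of_hasCompactSupport hθs.continuous hθc
    have eW : ∫ q, φ q.1 q.2 * w' q * θ q = ∫ q, θ q * W q := by
      refine integral_congr_ae (Eventually.of_forall fun q => ?_)
      simp only [hW]; ring
    have eV : ∫ q, θ q * V q = (∫ q, θ q * P0 q) - ∑ i, ∫ q, θ q * Pi i q := by
      rw [← integral_finsetSum _ fun i _ => Ii i, ← integral_sub I0 (integrable_finsetSum _ fun i _ => Ii i)]
      refine integral_congr_ae (Eventually.of_forall fun q => ?_)
      simp only [hV, Finset.mul_sum, mul_sub]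
    have IV : Integrable (fun q => θ q * V q) (volume : Measure (ℝ × (EuclideanSpace ℝ (Fin 3)))) :=
      hVloc.integrable_smul_left_of_hasCompactSupport hθs.continuous hθc
    simp_rw [smul_eq_mul, mul_sub]
    rw [integral_sub IW IV, ← eW, key, eV, sub_self]
  -- Step E: `W = V` a.e. on the half-space, hence on `Q'`
  have hae : ∀ᵐ q ∂(volume : Measure (ℝ × (EuclideanSpace ℝ (Fin 3)))),
      q ∈ (O : Set (ℝ × (EuclideanSpace ℝ (Fin 3)))) → W q - V q = 0 :=
    O.isOpen.ae_eq_zero_of_integral_contDiff_smul_eq_zero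
      ((hWi.locallyIntegrable.sub hVloc).locallyIntegrableOn _) hid
  set Qs' : Set (ℝ × (EuclideanSpace ℝ (Fin 3))) := Ioo (-L') 0 ×ˢ ball (0 : EuclideanSpace ℝ (Fin 3)) ρ'
    with hQs'
  have hsub : Qs' ⊆ Qs := prod_mono (Ioo_subset_Ioo_left (by linarith)) (ball_subset_ball hρ'ρ.le)
  have hsubO : Qs' ⊆ (O : Set (ℝ × (EuclideanSpace ℝ (Fin 3)))) := fun q hq => (hmemO q).2 hq.1.2
  have hwV : w =ᵐ[(volume : Measure (ℝ × (EuclideanSpace ℝ (Fin 3)))).restrict Qs'] V := by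
    rw [Filter.EventuallyEq, ae_restrict_iff' (measurableSet_Ioo.prod measurableSet_ball)]
    filter_upwards [hae] with q hq hq'
    have h1 : W q - V q = 0 := hq (hsubO hq')
    have h2 : W q = w q := by
      have hφq : φ q.1 q.2 = 1 := hφ1 q ⟨hq'.1.1.le, by linarith [hq'.1.2]⟩ hq'.2
      simp only [hW, hφq, hw', indicator_of_mem (hsub hq'), one_mul]
    linarith
  have hVr : MemLp V r ((volume : Measure (ℝ × (EuclideanSpace ℝ (Fin 3)))).restrict Qs') := hVm.restrict _
  refine ⟨hVr.ae_eq hwV.symm, ?_⟩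
  -- Step F: the norms
  rw [eLpNorm_congr_ae hwV, hCeq]
  have hPiae : ∀ i, AEStronglyMeasurable (Pi i) (volume : Measure (ℝ × (EuclideanSpace ℝ (Fin 3)))) :=
    fun i => (hPim i).1
  calc eLpNorm V r ((volume : Measure (ℝ × (EuclideanSpace ℝ (Fin 3)))).restrict Qs')
      ≤ eLpNorm V r (volume : Measure (ℝ × (EuclideanSpace ℝ (Fin 3)))) := eLpNorm_restrict_le _ _ _ _
    _ ≤ eLpNorm P0 r volume + eLpNorm (fun q => ∑ i, Pi i q) r volume :=
        eLpNorm_sub_le hP0m.1 (Finset.aestronglyMeasurable_fun_sum _ fun i _ => hPiae i) hr1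
    _ ≤ eLpNorm P0 r volume + ∑ i, eLpNorm (Pi i) r volume := by
        gcongr
        have : (fun q => ∑ i, Pi i q) = ∑ i, Pi i := by funext q; simp
        rw [this]
        exact eLpNorm_sum_le (fun i _ => hPiae i) hr1
    _ ≤ NK0 * eLpNorm H m volume + ∑ i, NK i * eLpNorm (F i) m volume :=
        add_le_add hP0n (Finset.sum_le_sum fun i _ => hPin i)
    _ ≤ NK0 * (ENNReal.ofReal (Kt + Kl) * eLpNorm w' m volume + ENNReal.ofReal (n3 * Kg) * eLpNorm g' m volume) +
        ∑ i, NK i * (ENNReal.ofReal K₀ * eLpNorm g' m volume + ENNReal.ofReal (2 * Kg) * eLpNorm w' m volume) := by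
        gcongr with i
        · exact eLpNorm_locH_le_of_bounds bs hφ hm1 hw'm hg'm hKt0 hKl0 hKg0 hKt hKl hKgi
        · exact eLpNorm_locF_le_of_bounds bs hφ hm1 hw'm hg'm hK₀0 hKg0 hK₀ hKgi i
    _ = Cw * eLpNorm w' m volume + Cg * eLpNorm g' m volume := by
        rw [← Finset.sum_mul, hCw, hCg]
        ring
    _ ≤ (Cw + Cg) * eLpNorm w' m volume + (Cw + Cg) * eLpNorm g' m volume :=
        add_le_add (mul_le_mul_of_nonneg_right le_self_add bot_le)
          (mul_le_mul_of_nonneg_right le_add_self bot_le)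
    _ = (Cw + Cg) * (eLpNorm w m (volume.restrict Qs) + eLpNorm g m (volume.restrict Qs)) := by
        rw [← hNw, ← hNg, mul_add]

end R3

end HeatDivForm

end Literature.Analysis.FluidPDE

end
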